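import Literature.AlgebraicGeometry.Resolution.BlowupChartRegular
import Literature.AlgebraicGeometry.Resolution.AlterationsNormalFormCentreFormalIdeal
import Literature.AlgebraicGeometry.Resolution.AdicCompletionRegular
import Mathlib.RingTheory.RegularLocalRing.Polynomial
import Summits.ResolutionOfSingularities.ResolutionOfSingularities.Theorems.WeightedInvariantHypersurfaceCentreAssemblyPrimeT
import HarnessLib

/-!
# The e.f.t. local weighted game: the successor local rings `B_𝔫` are regular for EVERY minimal move (zero weights allowed)

Topic: `Summits/ResolutionOfSingularities/ResolutionOfSingularities/Theorems`. Helper for the door item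
`HypersurfaceCentreConstruction` (statement `stmt-ResolutionOfSingularities-19897`, route `WeightedInvariant`), line
`local-engine` of `res-L1-w43-plan-1`; after-care of ORDER (o27) by res-type-070 (the regularity witness of the
successor-closed kill template `…/Negative/CanonicalGameFalseOfSuccessorClosedFamily.lean`, p511824).

[OURS · L1 W4.3] Replaces the role of NO printed item; NOT a statement of the manuscript
[claim: Hironaka2017, status: under-review]. AI work, weaker than expert review.

## Content (pure commutative algebra; no definitions)

`S` regular local, `u : Fin n → S` a MINIMAL system of generators of `𝔪` (`span (range u) = 𝔪`,
`𝔪.spanFinrank = n`), `w : Fin n → ℕ` ARBITRARY weights (zeros allowed: the centre of the move is the regular prime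
`P = (uⱼ : wⱼ > 0)`), `B = cobordantAlgebra' u w = S[t⁻¹, 𝒥ₙ(u, w) tⁿ]`.

* `isRegularRing_cobordantAlgebra_comp_quotient_span_s` — for an injection `σ` onto positively weighted indices,
  Włodarczyk's `S[t⁻¹, uⱼ t^{wⱼ} : j ∈ im σ] ⧸ (t⁻¹) ≅ (S ⧸ (u ∘ σ))[X]` is a regular ring: the sub-family `u ∘ σ` of the
  minimal system has independent differentials, so `S ⧸ (u ∘ σ)` is regular local (tree `isRegularLocalRing_quotient_span_range`)
  and the sub-family is weighted quasi-regular (tree `weightedQuasiRegular_of_linearIndependent_toCotangent`,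
  `cobordantAlgebra.nonempty_quotient_span_s_equiv`); polynomial rings over regular rings are regular (Mathlib).
* **`isRegularLocalRing_localization_cobordantAlgebra'`** — `B_𝔫` is a regular local ring at EVERY prime `𝔫 ∋ t⁻¹`, for
  every weight vector: transport along res-type-048's `exists_ringEquiv_cobordantAlgebra_comp` (`B ≅ S[t⁻¹, uⱼ t^{wⱼ} : wⱼ > 0]`,
  `t⁻¹ ↦ s`), then `s` is a non-zero-divisor with regular quotient ring (tree `isRegularLocalRing_localization_of_mem_of_quotient`).
  Generalises res-type-098's K3b-i `LocalGameEFTPointMove.isRegularLocalRing_of_isLocalization` (all weights positive) to the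
  moves the canonical game clause (c9′) actually plays.

So every successor position `(B_𝔫, g)` of the e.f.t. game at a minimal move is again a position (regular local, e.f.t.):
a census instantiating the kill templates owes no regularity witness.

## References

* J. Włodarczyk, *Functorial resolution by torus actions*, arXiv:2203.03090, Def. 2.3.5, §2.3.9, Rem. 2.3.10. [Wlodarczyk2022]
* H. Matsumura, *Commutative Ring Theory*, Thms. 14.2, 19.5. [Matsumura1987]
-/

noncomputable section

set_option linter.dupNamespace false -- mandated namespace of this single-conjunct summit

open IsLocalRing
open scoped LaurentPolynomial
open Literature.AlgebraicGeometry.Resolution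

namespace Summit.ResolutionOfSingularities.ResolutionOfSingularities.Cruxes.HypersurfaceCentreConstruction.LocalEngine

open Summit.ResolutionOfSingularities.ResolutionOfSingularities.Theorems
  (linearIndependent_toCotangent_of_span_eq_of_spanFinrank_eq)

section SuccessorRegular

variable {S : Type} [CommRing S] [IsRegularLocalRing S] {n : ℕ} (u : Fin n → S) (w : Fin n → ℕ)

/-- For a positively weighted SUB-family `u ∘ σ` of a minimal system of generators `u` of `𝔪` (regular local `S`),
Włodarczyk's exceptional fibre ring `S[t⁻¹, uⱼ t^{wⱼ} : j] ⧸ (t⁻¹) ≅ (S ⧸ (u ∘ σ))[X]` is a regular ring.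
[cite: Wlodarczyk2022, §2.3.9] -/
theorem isRegularRing_cobordantAlgebra_comp_quotient_span_s (hspan : Ideal.span (Set.range u) = maximalIdeal S)
    (hrk : (maximalIdeal S).spanFinrank = n) {n' : ℕ} (σ : Fin n' → Fin n) (hσ : Function.Injective σ)
    (hpos : ∀ j, 0 < w (σ j)) :
    IsRegularRing (cobordantAlgebra (u ∘ σ) (w ∘ σ) ⧸ Ideal.span {cobordantAlgebra.s (u ∘ σ) (w ∘ σ)}) := by
  classical
  have hu : ∀ i, u i ∈ maximalIdeal S := fun i => hspan ▸ Ideal.subset_span ⟨i, rfl⟩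
  have hu' : ∀ j, (u ∘ σ) j ∈ maximalIdeal S := fun j => hu (σ j)
  have hli' : LinearIndependent (ResidueField S) fun j => (maximalIdeal S).toCotangent ⟨(u ∘ σ) j, hu' j⟩ :=
    (linearIndependent_toCotangent_of_span_eq_of_spanFinrank_eq u hspan hrk).comp σ hσ
  haveI : IsRegularLocalRing (S ⧸ Ideal.span (Set.range (u ∘ σ))) :=
    isRegularLocalRing_quotient_span_range (u ∘ σ) hu' hli'
  have hwqr := weightedQuasiRegular_of_linearIndependent_toCotangent (u ∘ σ) (w ∘ σ) (fun j => hpos j) hu' hli'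
  obtain ⟨e⟩ := cobordantAlgebra.nonempty_quotient_span_s_equiv (u ∘ σ) (w ∘ σ) (fun j => hpos j) hwqr
  haveI : IsRegularRing (S ⧸ Ideal.span (Set.range (u ∘ σ))) := isRegularRing_of_isRegularLocalRing _
  haveI : IsRegularRing (MvPolynomial (Fin n') (S ⧸ Ideal.span (Set.range (u ∘ σ)))) := inferInstance
  exact IsRegularRing.of_ringEquiv e.symm

/-- For a positively weighted sub-family `u ∘ σ` of a minimal system `u` of `𝔪`, every local ring of Włodarczyk's
`S[t⁻¹, uⱼ t^{wⱼ} : j]` at a prime containing `s = t⁻¹` is regular (`s` is a non-zero-divisor with regular quotient ring).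
[cite: Wlodarczyk2022, §2.3.9] -/
theorem isRegularLocalRing_localization_cobordantAlgebra_comp (hspan : Ideal.span (Set.range u) = maximalIdeal S)
    (hrk : (maximalIdeal S).spanFinrank = n) {n' : ℕ} (σ : Fin n' → Fin n) (hσ : Function.Injective σ)
    (hpos : ∀ j, 0 < w (σ j)) (𝔫 : Ideal (cobordantAlgebra (u ∘ σ) (w ∘ σ))) [𝔫.IsPrime]
    (hs : cobordantAlgebra.s (u ∘ σ) (w ∘ σ) ∈ 𝔫) : IsRegularLocalRing (Localization.AtPrime 𝔫) := by
  have hreg := isRegularRing_cobordantAlgebra_comp_quotient_span_s u w hspan hrk σ hσ hpos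
  have hN : IsNoetherianRing (cobordantAlgebra (u ∘ σ) (w ∘ σ)) := cobordantAlgebra.isNoetherianRing (u ∘ σ) (w ∘ σ)
  exact @isRegularLocalRing_localization_of_mem_of_quotient _ _ hN _
    (cobordantAlgebra.s_mem_nonZeroDivisors (u ∘ σ) (w ∘ σ)) hreg 𝔫 _ hs

/-- **The successor local rings of every minimal move are regular.**  For `S` regular local, `u` a minimal system of
generators of `𝔪` (`span (range u) = 𝔪`, `𝔪.spanFinrank = n`) and ARBITRARY weights `w` (zeros allowed), the local ring
`B_𝔫` of the game-side carrier `B = cobordantAlgebra' u w = S[t⁻¹, 𝒥ₙ tⁿ]` at every prime `𝔫 ∋ t⁻¹` is a regular local ring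
(transport along `exists_ringEquiv_cobordantAlgebra_comp` to the positively weighted sub-family).  Generalises
`LocalGameEFTPointMove.isRegularLocalRing_of_isLocalization` (all weights positive). [cite: Wlodarczyk2022, §2.3.9] -/
theorem isRegularLocalRing_localization_cobordantAlgebra' (hspan : Ideal.span (Set.range u) = maximalIdeal S)
    (hrk : (maximalIdeal S).spanFinrank = n) (𝔫 : Ideal (cobordantAlgebra' u w)) [𝔫.IsPrime]
    (ht : cobordantT' u w ∈ 𝔫) : IsRegularLocalRing (Localization.AtPrime 𝔫) := by
  obtain ⟨n', σ, hσ, hsurj, hpos⟩ := exists_enum_pos_weights w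
  obtain ⟨e, -, he⟩ := exists_ringEquiv_cobordantAlgebra_comp u w σ hσ hsurj
  haveI : (𝔫.map e).IsPrime := Ideal.map_isPrime_of_equiv e
  have hs : cobordantAlgebra.s (u ∘ σ) (w ∘ σ) ∈ 𝔫.map e := he ▸ Ideal.mem_map_of_mem _ ht
  have h := isRegularLocalRing_localization_cobordantAlgebra_comp u w hspan hrk σ hσ hpos (𝔫.map e) hs
  exact (isRegularLocalRing_localization_map_ringEquiv_iff e 𝔫).mp h

/-- The same for an abstract localisation `[IsLocalization.AtPrime L 𝔫]` (the binder shape of res-type-098's K3b files).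
[cite: Wlodarczyk2022, §2.3.9] -/
theorem isRegularLocalRing_of_isLocalization_cobordantAlgebra' (hspan : Ideal.span (Set.range u) = maximalIdeal S)
    (hrk : (maximalIdeal S).spanFinrank = n) (𝔫 : Ideal (cobordantAlgebra' u w)) [𝔫.IsPrime]
    (ht : cobordantT' u w ∈ 𝔫) (L : Type) [CommRing L] [Algebra (cobordantAlgebra' u w) L] [IsLocalization.AtPrime L 𝔫] :
    IsRegularLocalRing L :=
  @IsRegularLocalRing.of_ringEquiv (Localization.AtPrime 𝔫) _
    (isRegularLocalRing_localization_cobordantAlgebra' u w hspan hrk 𝔫 ht) L _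
    (IsLocalization.algEquiv 𝔫.primeCompl (Localization.AtPrime 𝔫) L).toRingEquiv

end SuccessorRegular

end Summit.ResolutionOfSingularities.ResolutionOfSingularities.Cruxes.HypersurfaceCentreConstruction.LocalEngine

end
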